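import Summits.ResolutionOfSingularities.ResolutionOfSingularities.Theorems.ValuativeLuAlphaPTorsorDenseRange
import HarnessLib

/-!
# The dense chain over `O_{F₀}` (stmt-ResolutionOfSingularities-0641, line `pfaff-line-log-final-forms`, stub R2 `stub_stronglySmoothTopOverAbhyankarSubfield`)

Knaf–Kuhlmann 2009 (H. Knaf, F.-V. Kuhlmann, *Every place admits local uniformization in a
finite extension of the function field*, Adv. Math. 221 (2009) 428–453 = arXiv:math/0702856),
Prop. 3.11: "Let `(L|K,P)` be a finitely generated, separable extension within the completion of
`(K,P)`. Then `P` is strongly smoothly `O_K`-uniformizable." We prove it in the ambient vocabulary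
of `Literature/AlgebraicGeometry/Resolution/ValuedFunctionFields.lean` for a function field `K/k`
with a valuation ring `O`, dense (for `v`) over a subfield `F₀ ⊇ k` with `K/F₀` separably
generated: every finite `Z ⊆ O` is smoothly `O_{F₀} = O ∩ F₀`-uniformizable on a model of `K`.

This is the chain of the landed assembly `stronglySmoothlyUniformizable_top_of_dense`
(`ValuativeLuAlphaPTorsorDenseRangeAssembly.lean`, Thm. 1.5 first case) run over the base
`O_{F₀}` itself instead of `O ∩ im k` — so Knaf–Kuhlmann 2005 Thm. 1.1 and all hypotheses on the
residue fields disappear: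

* (a) the base: `F₀` is strongly smoothly `O_{F₀}`-uniformizable, trivially — the model is the
  valuation ring `O_{F₀}` itself (`isSmoothlyUniformizableIn_base_self`: the bottom subalgebra
  `⊥ ≅ O_{F₀}` is finitely presented and formally smooth over `O_{F₀}`, `Frac O_{F₀} = F₀` since
  `x ∈ O` or `x⁻¹ ∈ O`, and `z = z / 1`);
* (b) D3 + D1 in closed form (`denseTranscendentalTower`, with `K₀ := F₀`) climbs the separating
  transcendence basis `t` of `K/F₀` to `E = F₀(t)`;
* (c) D4 (`stub_separablePrimitiveElement`) writes `K = E(w)` with `w` separable over `E`;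
* (d) if `w ∈ E` we are done; otherwise D2 (`stub_denseHenselRoot`) replaces `w` by a Hensel
  root `η ∈ O`, Lemma 3.7 (2) (`isSmoothlyUniformizableIn_of_henselRoot`) makes `K` strongly
  smoothly `O ∩ E`-uniformizable and Cor. 3.6 (`knafKuhlmann2009_cor36`) composes down to
  `O_{F₀}`.
-/

-- single-problem summit: the doubled namespace component `ResolutionOfSingularities` is forced
set_option linter.dupNamespace false

open IsLocalRing

namespace Summit.ResolutionOfSingularities.ResolutionOfSingularities.Theorems.PfaffLine

open Literature.AlgebraicGeometry.Resolution

/-! ## The base case: a valued field over its own valuation ring -/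

/-- **The trivial base of the tower**: every subfield `F₀` of the valued field `(Ω, V)` is
strongly smoothly `O_{F₀}`-uniformizable, `O_{F₀} = V ∩ F₀` — the model is `O_{F₀}` itself (the
bottom `O_{F₀}`-subalgebra of `Ω`, isomorphic to `O_{F₀}`: finitely presented and formally smooth
over `O_{F₀}`), `Frac O_{F₀} = F₀` because `x ∈ V` or `x⁻¹ ∈ V`, and every `z ∈ V ∩ F₀` is `z / 1`.
[folklore] -/
theorem isSmoothlyUniformizableIn_base_self {Ω : Type*} [Field Ω] (V : ValuationSubring Ω)
    (F₀ : Subfield Ω) (Z : Set Ω) (hZ : ∀ z ∈ Z, z ∈ V ∧ z ∈ F₀) :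
    IsSmoothlyUniformizableIn ↥(V.toSubring ⊓ F₀.toSubring) V F₀ Z := by
  classical
  have hmem : ∀ x : Ω, x ∈ (⊥ : Subalgebra ↥(V.toSubring ⊓ F₀.toSubring) Ω) ↔ x ∈ V ∧ x ∈ F₀ := by
    intro x
    rw [Algebra.mem_bot]
    constructor
    · rintro ⟨r, rfl⟩
      exact r.2
    · intro hx
      exact ⟨⟨x, hx⟩, rfl⟩
  have hinj : Function.Injective (algebraMap ↥(V.toSubring ⊓ F₀.toSubring) Ω) :=
    Subtype.coe_injective
  have hAV : (⊥ : Subalgebra ↥(V.toSubring ⊓ F₀.toSubring) Ω).toSubring ≤ V.toSubring :=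
    fun x hx => ((hmem x).mp hx).1
  refine ⟨⊥, hAV, fun x hx => ((hmem x).mp hx).2, ?_, ?_, ?_, ?_⟩
  · -- finitely presented: `⊥ ≅ O_{F₀}`
    exact Algebra.FinitePresentation.equiv (Algebra.botEquivOfInjective hinj).symm
  · -- `Frac O_{F₀} = F₀`
    intro x hx
    rcases V.mem_or_inv_mem x with h | h
    · exact ⟨x, (hmem x).mpr ⟨h, hx⟩, 1, one_mem _, (div_one x).symm⟩
    · exact ⟨1, one_mem _, x⁻¹, (hmem _).mpr ⟨h, F₀.inv_mem hx⟩, by rw [one_div, inv_inv]⟩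
  · -- smooth at the centre: `⊥ ≅ O_{F₀}` is formally smooth over `O_{F₀}`
    haveI : Algebra.FormallySmooth ↥(V.toSubring ⊓ F₀.toSubring)
        (⊥ : Subalgebra ↥(V.toSubring ⊓ F₀.toSubring) Ω) :=
      Algebra.FormallySmooth.of_equiv (Algebra.botEquivOfInjective hinj).symm
    exact isSmoothAt_of_formallySmooth _
  · -- `Z ⊆ O_{F₀} = (O_{F₀})_q`
    intro z hz
    exact ⟨z, (hmem z).mpr (hZ z hz), 1, one_mem _, map_one _, (div_one z).symm⟩

/-! ## Knaf–Kuhlmann 2009, Prop. 3.11 over `O_{F₀}` -/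

/-- Stub R2 (reshape v6.8): **the dense chain over `O_{F₀}`** (Knaf–Kuhlmann 2009, Prop. 3.11)
— if `K` is dense over `F₀` and `K/F₀` is separably generated, then every finite `Z ⊆ O` is
smoothly `O_{F₀}`-uniformizable (`O_{F₀} = O ∩ F₀`): the base "`F₀` over `O_{F₀}`" is the
valuation ring itself (`isSmoothlyUniformizableIn_base_self`); D3 fed with D1
(`denseTranscendentalTower` with `K₀ := F₀`) climbs the separating transcendence basis; D4
`stub_separablePrimitiveElement` gives a separable primitive element `w`; D2
`stub_denseHenselRoot` turns it into a Hensel root, and Lemma 3.7 (2)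
`isSmoothlyUniformizableIn_of_henselRoot` with Cor. 3.6 `knafKuhlmann2009_cor36` conclude — as in
`stronglySmoothlyUniformizable_top_of_dense` but without Knaf–Kuhlmann 2005.
[cite: KnafKuhlmann2009, Prop. 3.11] -/
theorem stub_stronglySmoothTopOverAbhyankarSubfield :
    ∀ (k K : Type) [Field k] [Field K] [Algebra k K] (O : ValuationSubring K), (⊤ : IntermediateField k K).FG → ∀ F₀ : Subfield K, (algebraMap k K).fieldRange ≤ F₀ → Literature.AlgebraicGeometry.Resolution.SeparablyGeneratedOver F₀ ⊤ → (∀ x w : K, w ≠ 0 → ∃ a ∈ F₀, O.valuation (x - a) < O.valuation w) → ∀ Z : Finset K, (∀ z ∈ Z, z ∈ O) → Literature.AlgebraicGeometry.Resolution.IsSmoothlyUniformizableIn ↥(O.toSubring ⊓ F₀.toSubring) O ⊤ (Z : Set K) := by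
  intro k K _ _ _ O htopfg F₀ hkF₀ hsepgen hdense Z hZO
  classical
  have hZ : ∀ z ∈ Z, z ∈ O ∧ z ∈ (⊤ : Subfield K) := fun z hz => ⟨hZO z hz, trivial⟩
  -- (a) the base: `F₀` is strongly smoothly `O_{F₀}`-uniformizable (the valuation ring itself)
  have hF₀SU : ∀ Z : Finset K, (∀ z ∈ Z, z ∈ O ∧ z ∈ F₀) →
      IsSmoothlyUniformizableIn ↥(O.toSubring ⊓ F₀.toSubring) O F₀ (Z : Set K) := fun Z hZ =>
    isSmoothlyUniformizableIn_base_self O F₀ _ hZ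
  -- (b) the separating transcendence basis `t`, `E = F₀(t)` (D3 fed with D1, `K₀ := F₀`)
  obtain ⟨t, -, htai, hsep⟩ := hsepgen
  set E : IntermediateField F₀ K := IntermediateField.adjoin F₀ (t : Set K) with hE
  have hF₀E : F₀ ≤ E.toSubfield := fun x hx => E.algebraMap_mem ⟨x, hx⟩
  have hESU : ∀ Z : Finset K, (∀ z ∈ Z, z ∈ O ∧ z ∈ E.toSubfield) →
      IsSmoothlyUniformizableIn ↥(O.toSubring ⊓ F₀.toSubring) O E.toSubfield (Z : Set K) := by
    let y : Fin t.card → K := fun i => ((t.equivFin.symm i : t) : K)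
    have hy : AlgebraicIndependent F₀ y := htai.comp _ t.equivFin.symm.injective
    have hrange : Set.range y = (t : Set K) := by
      ext x
      constructor
      · rintro ⟨i, rfl⟩
        exact (t.equivFin.symm i).2
      · intro hx
        exact ⟨t.equivFin ⟨x, hx⟩, by simp [y]⟩
    have h := denseTranscendentalTower K O F₀ F₀ ⊤ t.card y le_rfl le_top (fun _ => trivial) hy
      (fun x _ w _ hw => hdense x w hw) hF₀SU
    rw [hrange] at h
    exact h
  -- (c) a separable primitive element `w` of `K | E` (D4)
  obtain ⟨s₀, hs₀⟩ := htopfg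
  obtain ⟨w, hwsep, hw⟩ := stub_separablePrimitiveElement E K s₀ fun x _ => hsep x trivial
  have hkE : ∀ c : k, algebraMap k K c ∈ E := fun c => hF₀E (hkF₀ ⟨c, rfl⟩)
  have hgen : Subfield.closure ((E.toSubfield : Set K) ∪ {w}) = ⊤ :=
    closure_union_singleton_eq_top E hkE s₀ hs₀ hw
  -- (d) either `E = K`, or a Hensel root (D2) + Lemma 3.7 (2) + Cor. 3.6
  by_cases hwE : w ∈ E
  · have hEtop : E.toSubfield = ⊤ := toSubfield_eq_top_of_mem E hwE hgen
    have h := hESU Z fun z hz => ⟨(hZ z hz).1, hEtop ▸ trivial⟩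
    rw [hEtop] at h
    exact h
  · have hwE' : w ∉ E.toSubfield := fun h => hwE ((IntermediateField.mem_toSubfield _ _).mp h)
    obtain ⟨η, hηO, hηgen, f, hfmon, hfcoeff, hfη, hfder⟩ :=
      stub_denseHenselRoot K O E.toSubfield w hwE' (exists_separable_equation E hwsep)
        (fun x _ w' _ hw' => by
          obtain ⟨a, haF₀, ha⟩ := hdense x w' hw'
          exact ⟨a, hF₀E haF₀, ha⟩)
    have hF := isSmoothlyUniformizableIn_of_henselRoot O E.toSubfield ⊤ hηO (hηgen.trans hgen)
      f hfmon hfcoeff hfη hfder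
    exact knafKuhlmann2009_cor36 O hF₀E le_top hESU (fun Z hZ => hF Z hZ) Z hZ

end Summit.ResolutionOfSingularities.ResolutionOfSingularities.Theorems.PfaffLine
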